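import Literature.Barriers.Schanuel.AxiomsDoNotForceSchanuelProofs
import Literature.NumberTheory.Transcendental.BKModelLimit
import Literature.NumberTheory.Transcendental.SEACQuasiminimalChart
import Literature.NumberTheory.Transcendental.EclPregeometryProofs
import Literature.ModelTheory.Quasiminimal.ContinuumAssembly
import HarnessLib

/-!
# Zilber's axioms minus Schanuel do not force Schanuel — the discharge

M. Bays, J. Kirby, *Pseudo-exponential maps, variants, and quasiminimality*, Algebra & Number
Theory 12 (2018) 493–549, §9.2 with Thm 1.7 / Thm 8.2 / Thm 6.9 / Thm 5.9: for every finitely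
generated partial exponential field with standard kernel `F_base = (K, D, θ, τ)` there is an
exponential field of cardinality continuum which is algebraically closed, has surjective
exponential map and standard kernel `τℤ`, is strongly exponentially-algebraically closed for
`ℚ`-linearly independent generic points over the base (axiom 4 in the kernel-preserving form),
has the countable closure property and is quasiminimal — and extends `F_base`. Combined with the
reduction `baysKirby2018_modelsWithoutSchanuel_of_softModels` (bases realising any prescribed
admissible algebraic relation) this proves the named fact
`Literature.Barriers.Schanuel.baysKirby2018_modelsWithoutSchanuel`.

The model is assembled from: the countable strongly exponentially-algebraically closed model over
the base (`BKModel.exists_countable_seac_model`, Thm 5.9 + Lemma 8.3), its quasiminimal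
pregeometry structure in the orbit language (`SEACModel.nonempty_orbitSetup`, Thm 6.9), and the
continuum model of a quasiminimal excellent class over it
(`Setup.exists_continuumModel_over_base`, Thm 6.9–6.10 with Kirby 2010 / BHHKK 2014).

## References

* M. Bays, J. Kirby, *Pseudo-exponential maps, variants, and quasiminimality*, Algebra & Number
  Theory 12 (2018) 493–549: Thm 1.7, §9.2, Thm 5.9, Thm 6.9, Thm 8.2, Lemma 8.3.
-/

noncomputable section

open Set

namespace Literature.Barriers.Schanuel

open Literature.ModelTheory.ExponentialFields Literature.ModelTheory.ExponentialFields.ExponentialRing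
open Literature.NumberTheory.Transcendental Literature.ModelTheory.Quasiminimal
open FirstOrder FirstOrder.Language

/-- The image of the base field lies in `ecl` of the image of a `ℚ`-basis of `D`
(`K = ℚ(D ∪ θ(D))`, `ecl S` is a subfield closed under `exp`). [folklore] -/
theorem range_subset_ecl_of_basis {K M : Type} [Field K] [CharZero K] [Field M] [CharZero M]
    [ExponentialRing M] {D : Submodule ℚ K} {θ : K → K} {τ : K}
    (hK : IsStdKernelPartialExpField K D θ τ) (ιM : K →+* M)
    (hexp : ∀ x ∈ D, exp (ιM x) = ιM (θ x)) {ι' : Type*} (b : Module.Basis ι' ℚ D) (k : K) :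
    ιM k ∈ ecl (range fun i => ιM (b i : K)) := by
  classical
  set S : Set M := range fun i => ιM (b i : K) with hS
  let E := Khovanskii.eclSubfield S
  -- `ιM D ⊆ ecl S`
  have hDspan : (D : Set K) ⊆ Submodule.span ℚ (range fun i => (b i : K)) := by
    intro d hd
    have : (⟨d, hd⟩ : D) ∈ Submodule.span ℚ (range b) := by rw [b.span_eq]; exact Submodule.mem_top
    have h := Submodule.apply_mem_span_image_of_mem_span D.subtype this
    rw [← range_comp] at h
    exact h
  have hD : ∀ d ∈ D, ιM d ∈ E := by
    intro d hd
    have hd' := hDspan hd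
    clear hd
    induction hd' using Submodule.span_induction with
    | mem x hx =>
      obtain ⟨i, rfl⟩ := hx
      exact subset_ecl S ⟨i, rfl⟩
    | zero => rw [map_zero]; exact E.zero_mem
    | add x y _ _ hx hy => rw [map_add]; exact E.add_mem hx hy
    | smul q x _ hx =>
      rw [map_rat_smul, Rat.smul_def]
      exact E.mul_mem (SubfieldClass.ratCast_mem E q) hx
  have hθ : ∀ d ∈ D, ιM (θ d) ∈ E := fun d hd => by
    rw [← hexp d hd]; exact Khovanskii.exp_mem_ecl (hD d hd)
  -- `ιM K = ιM ℚ(D ∪ θ D) ⊆ E`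
  have hle : (Subfield.closure ((D : Set K) ∪ θ '' D)).map ιM ≤ E := by
    rw [RingHom.map_field_closure, Subfield.closure_le]
    rintro _ ⟨x, hx | ⟨d, hd, rfl⟩, rfl⟩
    · exact hD x hx
    · exact hθ d hd
  have hk : ιM k ∈ (Subfield.closure ((D : Set K) ∪ θ '' D)).map ιM :=
    ⟨k, by rw [hK.closure_eq_top]; exact Subfield.mem_top k, rfl⟩
  exact hle hk

/-- Transcendence over `ℚ` is preserved by field embeddings (Mathlib's
`Transcendental.ringHom_of_comp_eq` with `f = id`). [folklore] -/
theorem transcendental_map {K F : Type*} [Field K] [CharZero K] [Field F] [CharZero F]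
    (ι : K →+* F) {t : K} (ht : Transcendental ℚ t) : Transcendental ℚ (ι t) :=
  ht.ringHom_of_comp_eq (RingHom.id ℚ) ι Function.surjective_id ι.injective
    (by ext q; simp)

/-- Partial embeddings of the orbit language of `Aut(M / ecl S)` fix `ecl S` pointwise.
[folklore] -/
theorem apply_eq_of_isQFEmbOn {M : Type} [Field M] [ExponentialRing M] [Γ : OrbitGroup M]
    {S : Set M} (hΓ : Γ.G = SEACModel.baseAut S) {σ : M → M}
    (hσ : IsQFEmbOn (orbitLanguage M) σ Set.univ) {x : M} (hx : x ∈ ecl S) : σ x = x := by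
  obtain ⟨ρ, hρ, hρx⟩ := (isQFEmbOn_iff.1 hσ) ![x] (fun _ => mem_univ _)
  have h := congrFun hρx 0
  simp only [Function.comp_apply, Matrix.cons_val_zero] at h
  rw [← h]
  rw [hΓ] at hρ
  exact SEACModel.apply_eq_of_mem_baseAut hρ hx

/-- **Bays–Kirby 2018, §9.2: Zilber's axioms without the Schanuel property do not force it.**
Discharge of `baysKirby2018_modelsWithoutSchanuel`: every admissible algebraic relation between
`ε` and `e = exp(ε)` is realised in an exponential field of size continuum which is algebraically
closed with surjective `exp` and standard kernel, strongly exponentially-algebraically closed for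
linearly independent points, with the countable closure property, and quasiminimal.
[cite: BaysKirby2018ANT, §9.2, Thm 1.7, Thm 5.9, Thm 6.9, Thm 8.2] -/
theorem baysKirby2018_modelsWithoutSchanuel_holds : baysKirby2018_modelsWithoutSchanuel := by
  classical
  refine baysKirby2018_modelsWithoutSchanuel_of_softModels fun K _ _ D θ τ hK => ?_
  obtain ⟨M, _, _, _, ιM, hac, hcount, hsurj, hexp, hker, hstrong, hSEAC, h4, hinf⟩ :=
    BKModel.exists_countable_seac_model hK
  haveI := hac
  haveI := hcount
  haveI := hK.finiteDimensional
  let b := Module.finBasis ℚ D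
  set S : Set M := range fun i => ιM (b i : K) with hS
  have hSfin : S.Finite := finite_range _
  letI Γ : OrbitGroup M := ⟨SEACModel.baseAut S⟩
  obtain ⟨St⟩ := SEACModel.nonempty_orbitSetup (Γ := Γ) (S := S) rfl hSfin hsurj hSEAC hinf
  have hfix : ∀ σ : M → M, IsQFEmbOn (orbitLanguage M) σ Set.univ → ∀ k, σ (ιM k) = ιM k :=
    fun σ hσ k => apply_eq_of_isQFEmbOn (Γ := Γ) rfl hσ (range_subset_ecl_of_basis hK ιM hexp b k)
  obtain ⟨F, _, _, _, ι, hcard, hqm, hacF, hsurjF, hexpF, hkerF, -, h4F, hcclF⟩ :=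
    St.exists_continuumModel_over_base D θ τ ιM hfix hsurj hexp hker hstrong h4
      (fun A => SEACModel.ecl_subset_ecl_union' S A)
  refine ⟨F, inferInstance, inferInstance, inferInstance, ι,
    ⟨hcard, hacF, hsurjF, ⟨ι τ, transcendental_map ι hK.transcendental, hkerF⟩,
      isLinIndepExpAlgClosed_of_closed_over_base ι D h4F,
      hasCountableClosureProperty_iff_finite.2 hcclF, hqm⟩, hexpF, hkerF⟩


/-! ### The soft technique class, refuted outright

Cone-audit record (D-0021/D-0026, 2026-08-15) for `Literature.Barriers.Schanuel.SoftDerivationOfSchanuel`: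
that declaration is the explicit TECHNIQUE CLASS of the barrier entry
`AxiomsDoNotForceSchanuel.lean` ("every exponential field of cardinality `𝔠` with Zilber's axioms
1, 2, 4, 5 of Bays–Kirby Thm 9.1 — axiom 4 in the printed `ℚ`-linear-independence form — and
quasiminimality has the Schanuel property"), i.e. the statement the barrier REFUTES, not a fact of
the source and not a target for provers. With the named fact now discharged
(`baysKirby2018_modelsWithoutSchanuel_holds` above), its negation is a theorem outright. -/

/-- **`SoftDerivationOfSchanuel` is false** (PROVED, unconditional; axioms `propext`,
`Classical.choice`, `Quot.sound`): Bays–Kirby's `𝔹_{x−y}` — cardinality `𝔠`, algebraically closed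
of characteristic zero with surjective `exp`, standard kernel `τℤ` (`τ` transcendental), strong
exponential-algebraic closedness in the linear-independence form, countable closure property,
quasiminimal, and `exp 1 = τ` — is a soft Zilber field WITHOUT the Schanuel property (the
`ℚ`-linearly independent tuple `(1, τ)` generates `ℚ(τ)` of transcendence degree `1 < 2`,
`not_schanuelProperty_of_kernel_relation`). This is `not_softDerivationOfSchanuel` applied to
`baysKirby2018_modelsWithoutSchanuel_holds`: "Examples such as these show that soft methods which
ignore transcendental number theory and analytic considerations cannot hope to work."
[cite: BaysKirby2018ANT, §9.2 (arXiv p. 28) with Thm 8.2 (axioms 1, 2, 4, 5) and Thm 1.7] -/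
theorem not_SoftDerivationOfSchanuel : ¬ SoftDerivationOfSchanuel :=
  not_softDerivationOfSchanuel baysKirby2018_modelsWithoutSchanuel_holds

/-- **A soft Zilber field without the Schanuel property exists** (PROVED, unconditional): the
object-class form of the barrier, `exists_isSoftZilberField_not_schanuelProperty` applied to the
discharged named fact. [cite: BaysKirby2018ANT, §9.2 (arXiv p. 28)] -/
theorem exists_isSoftZilberField_not_schanuelProperty_holds :
    ∃ (F : Type) (_ : Field F) (_ : CharZero F) (_ : ExponentialRing F),
      IsSoftZilberField F ∧ ¬ SchanuelProperty F :=
  exists_isSoftZilberField_not_schanuelProperty baysKirby2018_modelsWithoutSchanuel_holds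

/-- **Not every soft Zilber field has the Schanuel property** (PROVED, unconditional).
[cite: BaysKirby2018ANT, §9.2 (arXiv p. 28)] -/
theorem not_forall_isSoftZilberField_schanuelProperty_holds :
    ¬ ∀ (F : Type) [Field F] [CharZero F] [ExponentialRing F],
        IsSoftZilberField F → SchanuelProperty F :=
  not_forall_isSoftZilberField_schanuelProperty baysKirby2018_modelsWithoutSchanuel_holds

end Literature.Barriers.Schanuel
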